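import Summits.Ventures.CertifiedManyBodySolver.Observables.CanonicalCeilingClustersSourcedRows
import HarnessLib

/-!
# Two more decimal slots of the E15-anchored t′ = 0 canonical response ceiling on the `4 × 3` cluster line: g ∈ {3/10, 1/3}
# (companion of `Observables/CanonicalCeilingClustersSourcedRowsDecimals.lean` §5; same premises, same lineage; separate small module
# because that file sits at its size limit)

Cell hubbard-floor (D-0160 FLOOR cell FQ1; seat hubbard-floor-eng-1 g2, 2026-08-28; item (A) of hubbard-cq's WAKE-obsth-2-20260828T2202Z,
taken by the FLOOR engine successor). The continuum ceiling `canonicalCeiling_n7o8_tp0_clusterline_of_row_g6o7` (p671170; anchor = the FLOOR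
cell's S1 row `cert_pin1menuA0p_L3h0_U8_tp0_g6o7_E_j313009`, E15 = −2.5659698472 @ h_tree 1.21218, SDP dual certificate replayed by a second
reader) rounded UP to 7 dp (through `√2 > 1.4142135623`) at the two cq grid fields that had NO typed upper end on either book:
**3/10 ↦ Re ω(P₀^d) ≤ 1.0413536 @ h_tree 0.42426 · 1/3 ↦ ≤ 1.0768844 @ 0.47140** (exact x = 1.0413535054…, 1.0768843724…; words pre-stated
identically by four independent readers before this file). With the t′ = 0 floors of record there (0.2055132 / 0.2416828, files
`CanonicalFloorW32K4o7ContinuumTPHead.lean` / `…TPUpper.lean`) these are the first two-sided cells at 0.42426 / 0.47140.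

SIZE, STATED PLAINLY: kinematic scale (K5-class zero-field one-point ceiling of record 0.6445; kinematic maximum ≈ 1.2878); CONSISTENT WITH ANY
RESPONSE SHAPE below that scale, linear `m ≤ C·h` included; excludes nothing else. HONEST FRAMING: finite-field RESPONSE ceilings at LARGE
pairing fields (h_p = 4·h_tree) on infinite-volume ground states at fixed density ⅞, CONDITIONAL by name on the two `4 × 3` cluster cap nodes
(refereed) and the S1 sourced row; «m(h) ≤ m⁺ at h = …, CERTIFIED(KERNEL) modulo the nodes, class A0′ = (8, ⅞, 0)» — a ceiling never speaks to
presence; never onset, gap, Tc or order; superconductivity in the Hubbard model is NOT proved or disproved by any of this. Zero compute; no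
definition; no named fact; no `sorry`. References: R. B. Griffiths, Phys. Rev. 152 (1966) 240 §II; T. Koma, H. Tasaki, J. Stat. Phys. 76 (1994) 745 §1.
-/

noncomputable section

namespace Summit.Ventures.CertifiedManyBodySolver.Observables

open Matrix Finset Literature.Probability.LatticeModels
open Literature.MathematicalPhysics.QuantumLattice Literature.MathematicalPhysics.QuantumLattice.ThermodynamicLimit
open Literature.MathematicalPhysics.QuantumLattice.TwoCluster InfVolFermionState
open Summit.Ventures.CertifiedManyBodySolver Summit.Ventures.CertifiedManyBodySolver.Certificates
open scoped ComplexOrder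

section DecimalsS1b

variable {ω : InfVolFermionState 2}

/-- `1.4142135623 < √2`. [folklore] -/
private theorem sqrt_two_gt_14142135623 : (14142135623 / 10 ^ 10 : ℝ) < Real.sqrt 2 := by
  rw [Real.lt_sqrt (by norm_num)]; norm_num

/-- Slot rule for a ceiling: from `x ≤ N/(2(√2·g₂ − √2·g))` with `g < g₂`, `0 ≤ N` and the decidable side condition
`N·10¹⁰ ≤ M·2·14142135623·(g₂ − g)` conclude `x ≤ M`. [folklore] -/
private theorem chord_le_of_decimal_bound {x N g g₂ M : ℝ} (hgg : g < g₂) (hN : 0 ≤ N)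
    (hside : N * 10 ^ 10 ≤ M * (2 * 14142135623 * (g₂ - g))) (hx : x ≤ N / (2 * (Real.sqrt 2 * g₂ - Real.sqrt 2 * g))) : x ≤ M := by
  have hs := sqrt_two_gt_14142135623
  have hδ : 0 < g₂ - g := sub_pos.2 hgg
  have hden : 0 < 2 * (Real.sqrt 2 * g₂ - Real.sqrt 2 * g) := by
    have : Real.sqrt 2 * g₂ - Real.sqrt 2 * g = Real.sqrt 2 * (g₂ - g) := by ring
    rw [this]; positivity
  refine hx.trans ?_
  rw [div_le_iff₀ hden]
  have hM : 0 ≤ M := by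
    by_contra hM'
    have : M * (2 * 14142135623 * (g₂ - g)) < 0 := mul_neg_of_neg_of_pos (not_le.mp hM') (by positivity)
    nlinarith
  nlinarith [mul_le_mul_of_nonneg_left hs.le (by positivity : (0:ℝ) ≤ M * (2 * (g₂ - g)))]

/-- **Ceiling slot at `g = 3/10` (`h_tree ≈ 0.42426`) via the `6/7` row: `Re ω(P₀^d) ≤ 1.0413536`** for every translation-invariant density-`7/8`
minimiser of `E_{√2·3/10}` (exact chord `(A + B·g − E15)/(2√2(6/7 − g))` = 1.0413535054…, 7 dp UP). CONDITIONAL on the two `4 × 3` cluster nodes +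
`cert_pin1menuA0p_L3h0_U8_tp0_g6o7_E_j313009` (S1, kit j313009; dual certificate replayed). Kinematic scale; never speaks to presence. [cite: Griffiths1966, §II] -/
theorem canonicalCeiling_n7o8_tp0_clusterline_decimal_g3o10_r6o7 (hω : ω.IsTranslationInvariant) (hρ : ω.density = 7 / 8)
    (hmin : ∀ ω' : InfVolFermionState 2, ω'.IsTranslationInvariant → ω'.density = 7 / 8 →
      ω.meanEnergy (hubbardTTPrimeSourcedInteraction 1 0 8 0 dWaveFormFactor (Real.sqrt 2 * (3 / 10 : ℝ))) 1 ≤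
        ω'.meanEnergy (hubbardTTPrimeSourcedInteraction 1 0 8 0 dWaveFormFactor (Real.sqrt 2 * (3 / 10 : ℝ))) 1)
    (hC₁ : cert_capU2x2_4x3_U8_tp0_g3o14_mu3o2) (hC₂ : cert_capU3x2_4x3_U8_tp0_g1o4_mu7o4) (hN : cert_pin1menuA0p_L3h0_U8_tp0_g6o7_E_j313009) :
    (ω.expect (pairRegion (insert (0 : Site 2) unitSteps) 0) (localPairAt (insert 0 unitSteps) dWaveFormFactor 0)).re ≤ (325423 / 312500 : ℝ) :=
  chord_le_of_decimal_bound (by norm_num) (by push_cast; norm_num) (by push_cast; norm_num)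
    (canonicalCeiling_n7o8_tp0_clusterline_of_row_g6o7 (3 / 10 : ℝ) (by norm_num) (by norm_num) hω hρ hmin hC₁ hC₂ hN)

/-- **Ceiling slot at `g = 1/3` (`h_tree ≈ 0.47140`) via the `6/7` row: `Re ω(P₀^d) ≤ 1.0768844`** for every translation-invariant density-`7/8`
minimiser of `E_{√2·1/3}` (exact chord = 1.0768843724…, 7 dp UP). CONDITIONAL on the two `4 × 3` cluster nodes +
`cert_pin1menuA0p_L3h0_U8_tp0_g6o7_E_j313009` (S1, kit j313009; dual certificate replayed). Kinematic scale; never speaks to presence. [cite: Griffiths1966, §II] -/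
theorem canonicalCeiling_n7o8_tp0_clusterline_decimal_g1o3_r6o7 (hω : ω.IsTranslationInvariant) (hρ : ω.density = 7 / 8)
    (hmin : ∀ ω' : InfVolFermionState 2, ω'.IsTranslationInvariant → ω'.density = 7 / 8 →
      ω.meanEnergy (hubbardTTPrimeSourcedInteraction 1 0 8 0 dWaveFormFactor (Real.sqrt 2 * (1 / 3 : ℝ))) 1 ≤
        ω'.meanEnergy (hubbardTTPrimeSourcedInteraction 1 0 8 0 dWaveFormFactor (Real.sqrt 2 * (1 / 3 : ℝ))) 1)
    (hC₁ : cert_capU2x2_4x3_U8_tp0_g3o14_mu3o2) (hC₂ : cert_capU3x2_4x3_U8_tp0_g1o4_mu7o4) (hN : cert_pin1menuA0p_L3h0_U8_tp0_g6o7_E_j313009) :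
    (ω.expect (pairRegion (insert (0 : Site 2) unitSteps) 0) (localPairAt (insert 0 unitSteps) dWaveFormFactor 0)).re ≤ (2692211 / 2500000 : ℝ) :=
  chord_le_of_decimal_bound (by norm_num) (by push_cast; norm_num) (by push_cast; norm_num)
    (canonicalCeiling_n7o8_tp0_clusterline_of_row_g6o7 (1 / 3 : ℝ) (by norm_num) (by norm_num) hω hρ hmin hC₁ hC₂ hN)

end DecimalsS1b

end Summit.Ventures.CertifiedManyBodySolver.Observables

end
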